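import Mathlib
import Literature.AlgebraicGeometry.Resolution.CobordantGame
import Summits.ResolutionOfSingularities.ResolutionOfSingularities.Theorems.WeightedInvariantLocalWeightedDropGradedSliceWildTrivialization

/-!
# `WeightedInvariant.LocalWeightedDrop`: the wild slice at rank `0`, part 1 — FROBENIUS ROOT EXTRACTION on the frozen
# coordinate and the coefficients of the diagonal `(1+y_v)`-scalings

Route `ResolutionOfSingularities/WeightedInvariant`, crux `LocalWeightedDrop` (stmt-ResolutionOfSingularities-8899).
[OURS · L1 W4.3] — res-type-099 (gen 13) on res-L1-w43-plan-1 DEALS gen 10 #4 (2) / res-type-060 NAMING 10:55:26Z «099 TAKE (a)»: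
the RANK-`0` FLOOR (S3) `gradedWonBy_zero_of_slice_wild` of the repaired (minimal-valuation) wild slice clause of the graded-slice
line (ideator res-L1-w43-idea-1; tame half `gradedWonBy_of_slice_tame` p515424; Frobenius-cover form `gradedWonBy_wildLambdaFrob_
of_slice` p525479, res-type-060).  This file is the coefficient tool-kit for the COMMUTATION LEMMA (part 2,
`…GradedSliceWildRankZero`): the conjugate of a slice-graded coordinate change by the formal `q`-th root of the orbit scaling is
defined over `k[[y_v]]` — one extracts a `q`-th ROOT IN THE EXPONENT of `y_v` from a series all of whose `y_v`-exponents are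
multiples of `q`.  Nothing here is a statement of the manuscript under review on ladder RESOLUTION; not a verdict on card A.
AI proof, weaker than expert review.

* §1 `frobExp`, `frobFamily_eq_monomial` — res-type-060's Frobenius cover `frobFamily n q` (`y_v ↦ y_v^q`, p524471) is the monomial
  family of `frobExp`; `linExp_frobExp_*` (the image exponent multiplies the `y_v`-slot by `q`), injectivity;
  `coeff_linExp_subst_frobFamily` / `coeff_subst_frobFamily_eq_zero` (coefficients of `f(…, y_v^q)`), `subst_frobFamily_injective`,
  `not_X_dvd_subst_frobFamily`, `singular_subst_frobFamily`.
* §2 `frobRoot q f` — `y_v^{qt} ↦ y_v^t` on exponents; `subst_frobFamily_frobRoot`: if every `y_v`-exponent of `f` is a multiple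
  of `q` then `(frobRoot q f)(…, y_v^q) = f`; constant and linear coefficients of `frobRoot`.
* §3 `scaleFam τ = ((1+y_v)^{τ_i}·x_i)_i` (a family `k[[x]] → k[[x, y_v]]`) and **`coeff_subst_scaleFam`**: the coefficient of
  `x^d·y_v^t` in `f(scaleFam τ)` is `f_d · [y_v^t](1+y_v)^{τ·d}` — the substitution is diagonal on monomials.
-/

set_option linter.dupNamespace false -- mandated namespace of this single-conjunct summit
set_option autoImplicit false

namespace Summit.ResolutionOfSingularities.ResolutionOfSingularities.Theorems

namespace GradedGame

open MvPowerSeries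
open Literature.AlgebraicGeometry.Resolution

variable {k : Type} [Field k]

/-! ## §1 The Frobenius cover as a monomial family -/

section Frob

variable (m q : ℕ)

/-- Exponents of the Frobenius cover of the LAST coordinate: `y_v ↦ y_v^q`, `x_i ↦ x_i`. [OURS · L1 W4.3] -/
noncomputable def frobExp : Fin (m + 1) → (Fin (m + 1) →₀ ℕ) :=
  fun v => if v = Fin.last m then Finsupp.single (Fin.last m) q else Finsupp.single v 1

variable {m q}

/-- res-type-060's `frobFamily` is the monomial family of `frobExp`. [OURS · L1 W4.3] -/
theorem frobFamily_eq_monomial (n q : ℕ) :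
    frobFamily (k := k) n q = fun v => (monomial (frobExp (n + 1) q v) (1 : k) : MvPowerSeries (Fin (n + 1 + 1)) k) := by
  funext v
  unfold frobFamily frobExp
  by_cases hv : v = Fin.last (n + 1)
  · subst hv; simp [X_pow_eq]
  · rw [Function.update_of_ne hv, if_neg hv, X_def]

/-- The image exponent is unchanged off the last slot. [OURS · L1 W4.3] -/
theorem linExp_frobExp_castSucc (d : Fin (m + 1) →₀ ℕ) (j : Fin m) :
    linExp (frobExp m q) d (Fin.castSucc j) = d (Fin.castSucc j) := by
  classical
  rw [linExp_apply, Finsupp.sum]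
  have : ∀ v ∈ d.support, d v * frobExp m q v (Fin.castSucc j) = if v = Fin.castSucc j then d v else 0 := by
    intro v _
    unfold frobExp
    by_cases hv : v = Fin.last m
    · subst hv
      rw [if_pos rfl, Finsupp.single_apply, if_neg (Fin.castSucc_lt_last j).ne', mul_zero,
        if_neg (Fin.castSucc_lt_last j).ne']
    · rw [if_neg hv, Finsupp.single_apply]
      by_cases hvj : v = Fin.castSucc j
      · subst hvj; simp
      · rw [if_neg hvj, if_neg hvj, mul_zero]
  rw [Finset.sum_congr rfl this, Finset.sum_ite_eq']
  split_ifs with h0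
  · rfl
  · exact (Finsupp.notMem_support_iff.mp h0).symm

/-- The image exponent multiplies the last slot by `q`. [OURS · L1 W4.3] -/
theorem linExp_frobExp_last (d : Fin (m + 1) →₀ ℕ) : linExp (frobExp m q) d (Fin.last m) = d (Fin.last m) * q := by
  classical
  rw [linExp_apply, Finsupp.sum]
  have : ∀ v ∈ d.support, d v * frobExp m q v (Fin.last m) = if v = Fin.last m then d v * q else 0 := by
    intro v _
    unfold frobExp
    by_cases hv : v = Fin.last m
    · subst hv; simp
    · rw [if_neg hv, if_neg hv, Finsupp.single_apply, if_neg hv, mul_zero]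
  rw [Finset.sum_congr rfl this, Finset.sum_ite_eq']
  split_ifs with h0
  · rfl
  · rw [Finsupp.notMem_support_iff.mp h0, zero_mul]

/-- The exponent map of the Frobenius cover is injective (`q ≠ 0`). [OURS · L1 W4.3] -/
theorem linExp_frobExp_injective (hq : q ≠ 0) : Function.Injective (linExp (frobExp m q)) := by
  intro d d' h
  ext v
  refine Fin.lastCases ?_ (fun j => ?_) v
  · have := congrArg (fun θ => θ (Fin.last m)) h
    simp only [linExp_frobExp_last] at this
    exact Nat.eq_of_mul_eq_mul_right (Nat.pos_of_ne_zero hq) this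
  · have := congrArg (fun θ => θ (Fin.castSucc j)) h
    simpa only [linExp_frobExp_castSucc] using this

/-- An exponent whose last slot is a multiple of `q` is an image exponent. [OURS · L1 W4.3] -/
theorem eq_linExp_frobExp_of_dvd (μ : Fin (m + 1) →₀ ℕ) (t : ℕ) (ht : μ (Fin.last m) = q * t) :
    μ = linExp (frobExp m q) (Finsupp.update μ (Fin.last m) t) := by
  ext v
  refine Fin.lastCases ?_ (fun j => ?_) v
  · rw [linExp_frobExp_last, Finsupp.update_apply, if_pos rfl, ht, mul_comm]
  · rw [linExp_frobExp_castSucc, Finsupp.update_apply, if_neg (Fin.castSucc_lt_last j).ne]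

variable (n q : ℕ)

/-- Coefficients of `f(…, y_v^q)` AT image exponents. [OURS · L1 W4.3] -/
theorem coeff_linExp_subst_frobFamily (hq : 0 < q) (f : MvPowerSeries (Fin (n + 1 + 1)) k) (d : Fin (n + 1 + 1) →₀ ℕ) :
    coeff (linExp (frobExp (n + 1) q) d) (subst (frobFamily (k := k) n q) f) = coeff d f := by
  have hS := hasSubst_frobFamily (k := k) (n := n) q hq
  rw [frobFamily_eq_monomial] at hS ⊢
  exact coeff_linExp_subst_monomial (frobExp (n + 1) q) hS (linExp_frobExp_injective hq.ne') f d

/-- Coefficients of `f(…, y_v^q)` vanish OFF the image, i.e. at exponents whose `y_v`-slot is not a multiple of `q`.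
[OURS · L1 W4.3] -/
theorem coeff_subst_frobFamily_eq_zero (hq : 0 < q) (f : MvPowerSeries (Fin (n + 1 + 1)) k) (μ : Fin (n + 1 + 1) →₀ ℕ)
    (hμ : ¬ q ∣ μ (Fin.last (n + 1))) : coeff μ (subst (frobFamily (k := k) n q) f) = 0 := by
  have hS := hasSubst_frobFamily (k := k) (n := n) q hq
  rw [frobFamily_eq_monomial] at hS ⊢
  refine coeff_subst_monomial_eq_zero (frobExp (n + 1) q) hS f μ fun d h => hμ ?_
  rw [← h, linExp_frobExp_last]
  exact Dvd.intro_left _ rfl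

/-- The Frobenius cover is injective on series. [OURS · L1 W4.3] -/
theorem subst_frobFamily_injective (hq : 0 < q) {f g : MvPowerSeries (Fin (n + 1 + 1)) k}
    (h : subst (frobFamily (k := k) n q) f = subst (frobFamily (k := k) n q) g) : f = g := by
  ext d
  rw [← coeff_linExp_subst_frobFamily n q hq f d, ← coeff_linExp_subst_frobFamily n q hq g d, h]

/-- `s ∤ f ⇒ s ∤ f(…, y_v^q)` (the exceptional variable `s = X 0` is not the frozen one). [OURS · L1 W4.3] -/
theorem not_X_dvd_subst_frobFamily (hq : 0 < q) {f : MvPowerSeries (Fin (n + 1 + 1)) k} (hf : ¬ X 0 ∣ f) :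
    ¬ X 0 ∣ subst (frobFamily (k := k) n q) f := by
  rw [X_dvd_iff] at hf ⊢
  push Not at hf ⊢
  obtain ⟨d, hd0, hd⟩ := hf
  refine ⟨linExp (frobExp (n + 1) q) d, ?_, by rwa [coeff_linExp_subst_frobFamily n q hq]⟩
  have h0 : (0 : Fin (n + 1 + 1)) = Fin.castSucc 0 := rfl
  rw [h0, linExp_frobExp_castSucc, ← h0, hd0]

/-- The Frobenius cover keeps constant terms. [OURS · L1 W4.3] -/
theorem constantCoeff_subst_frobFamily (hq : 0 < q) (f : MvPowerSeries (Fin (n + 1 + 1)) k) :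
    constantCoeff (subst (frobFamily (k := k) n q) f) = constantCoeff f := by
  rw [← coeff_zero_eq_constantCoeff_apply, ← coeff_zero_eq_constantCoeff_apply]
  have h0 : (0 : Fin (n + 1 + 1) →₀ ℕ) = linExp (frobExp (n + 1) q) 0 := by
    unfold linExp; simp
  conv_lhs => rw [h0]
  exact coeff_linExp_subst_frobFamily n q hq f 0

/-- The Frobenius cover keeps the linear coefficients off the frozen slot. [OURS · L1 W4.3] -/
theorem coeff_single_subst_frobFamily_castSucc (hq : 0 < q) (f : MvPowerSeries (Fin (n + 1 + 1)) k) (j : Fin (n + 1)) :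
    coeff (Finsupp.single (Fin.castSucc j) 1) (subst (frobFamily (k := k) n q) f) = coeff (Finsupp.single (Fin.castSucc j) 1) f := by
  have h : (Finsupp.single (Fin.castSucc j) 1 : Fin (n + 1 + 1) →₀ ℕ) =
      linExp (frobExp (n + 1) q) (Finsupp.single (Fin.castSucc j) 1) := by
    unfold linExp frobExp
    rw [Finsupp.sum_single_index (by simp), if_neg (Fin.castSucc_lt_last j).ne, one_smul]
  conv_lhs => rw [h]
  exact coeff_linExp_subst_frobFamily n q hq f _

/-- **A SINGULAR GERM STAYS SINGULAR ON THE FROBENIUS COVER, AND CONVERSELY `f(…, y_v^q) ∈ 𝔪²` forces `f ∈ 𝔪²` as soon as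
`q ≥ 1`** — we only need: `f ∈ 𝔪² ⇒ f(…, y_v^q) ∈ 𝔪²`. [OURS · L1 W4.3] -/
theorem singular_subst_frobFamily (hq : 0 < q) {f : MvPowerSeries (Fin (n + 1 + 1)) k}
    (hf : constantCoeff f = 0 ∧ ∀ j, coeff (Finsupp.single j 1) f = 0) :
    constantCoeff (subst (frobFamily (k := k) n q) f) = 0 ∧ ∀ j, coeff (Finsupp.single j 1) (subst (frobFamily (k := k) n q) f) = 0 :=
  (FormalCoordChange.two_le_order_iff _).mp (FormalCoordChange.two_le_order_subst _ (fun i => by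
    unfold frobFamily
    by_cases hi : i = Fin.last (n + 1)
    · subst hi; simp [constantCoeff_X, zero_pow hq.ne']
    · rw [Function.update_of_ne hi]; exact constantCoeff_X i) f ((FormalCoordChange.two_le_order_iff f).mpr hf))

/-- `(1 + y_v)(…, y_v^q) = 1 + y_v^q`. [OURS · L1 W4.3] -/
theorem subst_frobFamily_one_add_X (hq : 0 < q) :
    subst (frobFamily (k := k) n q) ((1 : MvPowerSeries (Fin (n + 1 + 1)) k) + X (Fin.last (n + 1))) =
      1 + X (Fin.last (n + 1)) ^ q := by
  have hS := hasSubst_frobFamily (k := k) (n := n) q hq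
  rw [← coe_substAlgHom hS, map_add, map_one, substAlgHom_X]
  simp [frobFamily]

/-- **POWERS `(1+y_v)^{qM}` LIVE ON THE FROBENIUS COVER**: in a ring with `(1+y_v)^q = 1 + y_v^q` (e.g. `q = p^e` in
characteristic `p`), every `y_v`-exponent of `(1+y_v)^{qM}` is a multiple of `q`. [OURS · L1 W4.3] -/
theorem coeff_one_add_X_pow_mul_eq_zero (hq : 0 < q)
    (hfrob : ((1 : MvPowerSeries (Fin (n + 1 + 1)) k) + X (Fin.last (n + 1))) ^ q = 1 + X (Fin.last (n + 1)) ^ q)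
    (M : ℕ) (μ : Fin (n + 1 + 1) →₀ ℕ) (hμ : ¬ q ∣ μ (Fin.last (n + 1))) :
    coeff μ (((1 : MvPowerSeries (Fin (n + 1 + 1)) k) + X (Fin.last (n + 1))) ^ (q * M)) = 0 := by
  have hS := hasSubst_frobFamily (k := k) (n := n) q hq
  have h : ((1 : MvPowerSeries (Fin (n + 1 + 1)) k) + X (Fin.last (n + 1))) ^ (q * M) =
      subst (frobFamily (k := k) n q) (((1 : MvPowerSeries (Fin (n + 1 + 1)) k) + X (Fin.last (n + 1))) ^ M) := by
    rw [subst_pow hS, subst_frobFamily_one_add_X n q hq, ← hfrob, pow_mul]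
  rw [h]
  exact coeff_subst_frobFamily_eq_zero n q hq _ μ hμ

end Frob

/-! ## §2 Root extraction in the exponent of the frozen coordinate -/

section Root

variable {m : ℕ} (q : ℕ)

/-- FROBENIUS ROOT EXTRACTION on the last coordinate: the coefficient of `x^e·y_v^t` in `frobRoot q f` is the coefficient of
`x^e·y_v^{qt}` in `f`.  When every `y_v`-exponent of `f` is a multiple of `q`, `(frobRoot q f)(…, y_v^q) = f`
(`subst_frobFamily_frobRoot`). [OURS · L1 W4.3] -/
noncomputable def frobRoot (f : MvPowerSeries (Fin (m + 1)) k) : MvPowerSeries (Fin (m + 1)) k :=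
  fun E => coeff (linExp (frobExp m q) E) f

/-- Coefficients of `frobRoot`. [OURS · L1 W4.3] -/
theorem coeff_frobRoot (f : MvPowerSeries (Fin (m + 1)) k) (E : Fin (m + 1) →₀ ℕ) :
    coeff E (frobRoot q f) = coeff (linExp (frobExp m q) E) f :=
  rfl

/-- `frobRoot` keeps the constant term. [OURS · L1 W4.3] -/
theorem constantCoeff_frobRoot (f : MvPowerSeries (Fin (m + 1)) k) : constantCoeff (frobRoot q f) = constantCoeff f := by
  rw [← coeff_zero_eq_constantCoeff_apply, ← coeff_zero_eq_constantCoeff_apply, coeff_frobRoot]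
  congr 1

/-- `frobRoot` keeps the linear coefficients off the last slot. [OURS · L1 W4.3] -/
theorem coeff_single_castSucc_frobRoot (f : MvPowerSeries (Fin (m + 1)) k) (j : Fin m) :
    coeff (Finsupp.single (Fin.castSucc j) 1) (frobRoot q f) = coeff (Finsupp.single (Fin.castSucc j) 1) f := by
  rw [coeff_frobRoot]
  congr 1
  unfold linExp frobExp
  rw [Finsupp.sum_single_index (by simp), if_neg (Fin.castSucc_lt_last j).ne, one_smul]

/-- The linear coefficient of `frobRoot q f` at the last slot is the coefficient of `y_v^q` in `f`. [OURS · L1 W4.3] -/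
theorem coeff_single_last_frobRoot (f : MvPowerSeries (Fin (m + 1)) k) :
    coeff (Finsupp.single (Fin.last m) 1) (frobRoot q f) = coeff (Finsupp.single (Fin.last m) q) f := by
  rw [coeff_frobRoot]
  congr 1
  unfold linExp frobExp
  rw [Finsupp.sum_single_index (by simp), if_pos rfl, one_smul]

end Root

/-- **ROOT EXTRACTION INVERTS THE FROBENIUS COVER ON ITS IMAGE**: if every `y_v`-exponent of `f` is a multiple of `q ≥ 1`, then
`(frobRoot q f)(…, y_v^q) = f`. [OURS · L1 W4.3] -/
theorem subst_frobFamily_frobRoot (n q : ℕ) (hq : 0 < q) (f : MvPowerSeries (Fin (n + 1 + 1)) k)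
    (hf : ∀ μ, coeff μ f ≠ 0 → q ∣ μ (Fin.last (n + 1))) :
    subst (frobFamily (k := k) n q) (frobRoot q f) = f := by
  ext μ
  by_cases hμ : q ∣ μ (Fin.last (n + 1))
  · obtain ⟨t, ht⟩ := hμ
    rw [eq_linExp_frobExp_of_dvd μ t ht, coeff_linExp_subst_frobFamily n q hq, coeff_frobRoot]
  · rw [coeff_subst_frobFamily_eq_zero n q hq _ μ hμ]
    by_contra h
    exact hμ (hf μ (Ne.symm h))

/-! ## §3 The diagonal `(1+y_v)`-scalings `x_i ↦ (1+y_v)^{τ_i}·x_i` -/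

section Scale

variable {m : ℕ} (τ : Fin m → ℕ)

/-- The diagonal scaling family `x_i ↦ (1 + y_v)^{τ_i}·x_i` from `k[[x]]` (`m` variables) into `k[[x, y_v]]` (`y_v` = last).
[OURS · L1 W4.3] -/
noncomputable def scaleFam : Fin m → MvPowerSeries (Fin (m + 1)) k :=
  fun i => (1 + X (Fin.last m)) ^ (τ i) * X (Fin.castSucc i)

/-- The scaling family has zero constant terms. [OURS · L1 W4.3] -/
theorem constantCoeff_scaleFam (i : Fin m) : constantCoeff (scaleFam (k := k) τ i) = 0 := by
  simp [scaleFam, constantCoeff_X]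

/-- … hence is substitutable. [OURS · L1 W4.3] -/
theorem hasSubst_scaleFam : HasSubst (scaleFam (k := k) τ) := hasSubst_of_constantCoeff_zero (constantCoeff_scaleFam τ)

/-- The `τ`-weight of an exponent. [OURS · L1 W4.3] -/
def tauDeg (d : Fin m →₀ ℕ) : ℕ := ∑ i, τ i * d i

/-- The image of the monomial `x^d` under the scaling: `(1+y_v)^{τ·d} · x^d`. [OURS · L1 W4.3] -/
theorem prod_pow_scaleFam (d : Fin m →₀ ℕ) :
    (d.prod fun i e => (scaleFam (k := k) τ i) ^ e) = (1 + X (Fin.last m)) ^ (tauDeg τ d) * monomial (linExp (cylExp m) d) 1 := by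
  classical
  unfold scaleFam tauDeg
  rw [Finsupp.prod_fintype _ _ (fun i => pow_zero _)]
  simp_rw [mul_pow, ← pow_mul]
  rw [Finset.prod_mul_distrib, Finset.prod_pow_eq_pow_sum, ← prod_pow_monomial_linExp, Finsupp.prod_fintype _ _ (fun i => pow_zero _)]
  congr 1

/-- A pure power of `1 + y_v` only has exponents on the `y_v`-axis; its coefficient at `x^D·y_v^t`-shifted exponents.
[OURS · L1 W4.3] -/
theorem coeff_one_add_X_pow_mul_monomial (N : ℕ) (d d' : Fin m →₀ ℕ) (t : ℕ) :
    coeff (linExp (cylExp m) d + Finsupp.single (Fin.last m) t)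
        (((1 + X (Fin.last m)) ^ N : MvPowerSeries (Fin (m + 1)) k) * monomial (linExp (cylExp m) d') 1) =
      if d' = d then coeff (Finsupp.single (Fin.last m) t) ((1 + X (Fin.last m)) ^ N : MvPowerSeries (Fin (m + 1)) k) else 0 := by
  classical
  rw [coeff_mul_monomial, mul_one]
  by_cases hd : d' = d
  · subst hd
    rw [if_pos le_self_add, if_pos rfl, add_tsub_cancel_left]
  · rw [if_neg hd]
    split_ifs with hle
    · -- `E - D` is not on the `y_v`-axis unless `d' = d`
      by_contra hne
      obtain ⟨s, hs⟩ := exists_eq_single_of_coeff_one_add_X_pow (Fin.last m) N _ hne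
      apply hd
      ext j
      have h1 := DFunLike.congr_fun hs (Fin.castSucc j)
      simp only [Finsupp.coe_tsub, Pi.sub_apply, Finsupp.coe_add, Pi.add_apply, linExp_cylExp_castSucc,
        Finsupp.single_apply, if_neg (Fin.castSucc_lt_last j).ne', add_zero] at h1
      have h2 := hle (Fin.castSucc j)
      simp only [Finsupp.coe_add, Pi.add_apply, linExp_cylExp_castSucc, Finsupp.single_apply,
        if_neg (Fin.castSucc_lt_last j).ne', add_zero] at h2
      omega
    · rfl

/-- **COEFFICIENTS OF A DIAGONALLY SCALED SERIES**: the coefficient of `x^d·y_v^t` in `f((1+y_v)^{τ_i}x_i)` is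
`f_d · [y_v^t](1+y_v)^{τ·d}`. [OURS · L1 W4.3] -/
theorem coeff_subst_scaleFam (f : MvPowerSeries (Fin m) k) (d : Fin m →₀ ℕ) (t : ℕ) :
    coeff (linExp (cylExp m) d + Finsupp.single (Fin.last m) t) (subst (scaleFam (k := k) τ) f) =
      coeff d f * coeff (Finsupp.single (Fin.last m) t) ((1 + X (Fin.last m)) ^ (tauDeg τ d) : MvPowerSeries (Fin (m + 1)) k) := by
  classical
  rw [coeff_subst (hasSubst_scaleFam τ), finsum_eq_single _ d]
  · rw [prod_pow_scaleFam, coeff_one_add_X_pow_mul_monomial, if_pos rfl, smul_eq_mul]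
  · intro d' hd'
    rw [prod_pow_scaleFam, coeff_one_add_X_pow_mul_monomial, if_neg hd', smul_zero]

/-- Every exponent of `k[[x, y_v]]` splits as (image of its `x`-part) + (its `y_v`-slot). [OURS · L1 W4.3] -/
theorem eq_linExp_cylExp_add_single (E : Fin (m + 1) →₀ ℕ) :
    E = linExp (cylExp m) (Finsupp.equivFunOnFinite.symm fun j => E (Fin.castSucc j)) + Finsupp.single (Fin.last m) (E (Fin.last m)) := by
  ext j
  refine Fin.lastCases ?_ (fun l => ?_) j
  · rw [Finsupp.add_apply, linExp_cylExp_last, Finsupp.single_eq_same, zero_add]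
  · rw [Finsupp.add_apply, linExp_cylExp_castSucc, Finsupp.single_apply, if_neg (Fin.castSucc_lt_last l).ne', add_zero]
    simp

/-- Support form of `coeff_subst_scaleFam`: a non-zero coefficient of the scaled series at `E` forces a non-zero coefficient of
`f` at the `x`-part of `E` and of `(1+y_v)^{τ·(x-part)}` at the `y_v`-part. [OURS · L1 W4.3] -/
theorem coeff_subst_scaleFam_ne_zero (f : MvPowerSeries (Fin m) k) (E : Fin (m + 1) →₀ ℕ)
    (hE : coeff E (subst (scaleFam (k := k) τ) f) ≠ 0) :
    coeff (Finsupp.equivFunOnFinite.symm fun j => E (Fin.castSucc j) : Fin m →₀ ℕ) f ≠ 0 ∧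
      coeff (Finsupp.single (Fin.last m) (E (Fin.last m)))
        ((1 + X (Fin.last m)) ^ (tauDeg τ (Finsupp.equivFunOnFinite.symm fun j => E (Fin.castSucc j))) :
          MvPowerSeries (Fin (m + 1)) k) ≠ 0 := by
  rw [eq_linExp_cylExp_add_single E, coeff_subst_scaleFam] at hE
  exact ⟨left_ne_zero_of_mul hE, right_ne_zero_of_mul hE⟩

end Scale

end GradedGame

end Summit.ResolutionOfSingularities.ResolutionOfSingularities.Theorems
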